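import Literature.Probability.LatticeModels.RhombicTrackTransport
import Literature.Probability.Percolation.IsoradialProofs
import HarnessLib

/-!
# Restricting a rhombic embedding to the faces that occur

The face type `F` of a rhombic embedding `emb : RhombicEmbedding G F` may contain elements that
are the face of no dart ("unused faces"): the tiling condition `IsRhombicTiling` only asks
`c : F → ℂ` to be injective, and nothing locates an unused face. Statements about the dual graph
`G*` (vertex type `F`, `Literature.Probability.LatticeModels.IsoradialDual`) that need a
*countable* vertex type — every application of the tree's percolation lemmas — therefore go
through the restriction of `emb` to its **used faces**, `emb.restrictFaces`, an embedding of the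
same graph with the same drawing, the same rhombi and the same canonical measure, whose face
type `emb.usedFaces` is countable as soon as `V` is:

* `RhombicEmbedding.usedFaces`, `RhombicEmbedding.restrictFaces` (deliberate dot-notation
  extensions of the `LatticeModels` structure, as `IsRhombicTiling` in `Isoradial.lean`);
* invariance: `halfAngle_restrictFaces`, `IsIsoradial.restrictFaces`,
  `HasBoundedAngles.restrictFaces`, `edgeWeight_restrictFaces`,
  `isoradialPercolation_restrictFaces` (same measure), `rhombus_restrictFaces`,
  `IsRhombicTiling.restrictFaces`;
* tracks: `isSideCompatible_restrictFaces` (the side map `(v, f) ↦ (v, ↑f)`), hence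
  `SquareGridPropertyGM.restrictFaces`, `HasSquareGridPropertyGM.restrictFaces` (and back);
* `countable_usedFaces`.

## References

* G. R. Grimmett, I. Manolescu, *Bond percolation on isoradial graphs*, PTRF 159 (2014),
  arXiv:1204.0505, §2.1, §4.1–4.2 (bookkeeping for the class 𝒢 and its dual).
-/

noncomputable section

namespace Literature.Probability.Percolation

open Literature.Probability.LatticeModels Literature.Probability.LatticeModels.RhombicEmbedding

variable {V F : Type*} {G : SimpleGraph V}

/-- **The used faces**: faces lying to the left or to the right of some dart. [folklore] -/
def _root_.Literature.Probability.LatticeModels.RhombicEmbedding.usedFaces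
    (emb : RhombicEmbedding G F) : Set F :=
  {f | ∃ d : G.Dart, emb.leftFace d = f ∨ emb.rightFace d = f}

/-- **The embedding restricted to its used faces**: same drawing, faces retyped as elements of
`emb.usedFaces`. [folklore] -/
def _root_.Literature.Probability.LatticeModels.RhombicEmbedding.restrictFaces
    (emb : RhombicEmbedding G F) : RhombicEmbedding G emb.usedFaces where
  z := emb.z
  c f := emb.c f
  leftFace d := ⟨emb.leftFace d, d, Or.inl rfl⟩
  rightFace d := ⟨emb.rightFace d, d, Or.inr rfl⟩

variable (emb : RhombicEmbedding G F)

/-- Vertex positions are unchanged. [folklore] -/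
@[simp] theorem restrictFaces_z : emb.restrictFaces.z = emb.z := rfl

/-- Face centres are unchanged. [folklore] -/
@[simp] theorem restrictFaces_c (f : emb.usedFaces) : emb.restrictFaces.c f = emb.c f := rfl

/-- Left faces are unchanged (as elements of `F`). [folklore] -/
@[simp] theorem coe_restrictFaces_leftFace (d : G.Dart) :
    (emb.restrictFaces.leftFace d : F) = emb.leftFace d := rfl

/-- Right faces are unchanged (as elements of `F`). [folklore] -/
@[simp] theorem coe_restrictFaces_rightFace (d : G.Dart) :
    (emb.restrictFaces.rightFace d : F) = emb.rightFace d := rfl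

/-- Half-angles are unchanged. [folklore] -/
@[simp] theorem halfAngle_restrictFaces (d : G.Dart) :
    emb.restrictFaces.halfAngle d = emb.halfAngle d := rfl

/-- Edge weights are unchanged. [folklore] -/
@[simp] theorem edgeWeight_restrictFaces : emb.restrictFaces.edgeWeight = emb.edgeWeight := rfl

/-- **The canonical measure is unchanged.** [folklore] -/
@[simp] theorem isoradialPercolation_restrictFaces :
    emb.restrictFaces.isoradialPercolation = emb.isoradialPercolation := rfl

/-- Rhombi are unchanged. [folklore] -/
@[simp] theorem rhombus_restrictFaces (e : G.edgeSet) :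
    emb.restrictFaces.rhombus e = emb.rhombus e := rfl

variable {emb}

/-- Isoradiality is unchanged. [folklore] -/
theorem _root_.Literature.Probability.LatticeModels.RhombicEmbedding.IsIsoradial.restrictFaces
    (h : emb.IsIsoradial) : emb.restrictFaces.IsIsoradial where
  norm_sub_eq_one d := h.norm_sub_eq_one d
  leftFace_symm d := Subtype.ext (h.leftFace_symm d)
  c_leftFace_ne d := h.c_leftFace_ne d
  z_injective := h.z_injective

/-- The bounded-angles property is unchanged. [folklore] -/
theorem _root_.Literature.Probability.LatticeModels.RhombicEmbedding.HasBoundedAngles.restrictFaces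
    {ε : ℝ} (h : emb.HasBoundedAngles ε) : emb.restrictFaces.HasBoundedAngles ε := h

/-- The tiling condition is unchanged. [folklore] -/
theorem _root_.Literature.Probability.LatticeModels.RhombicEmbedding.IsRhombicTiling.restrictFaces
    (h : emb.IsRhombicTiling) : emb.restrictFaces.IsRhombicTiling where
  disjoint_interior := h.disjoint_interior
  iUnion_rhombus := h.iUnion_rhombus
  c_injective _ _ hfg := Subtype.ext (h.c_injective hfg)

/-- **The used faces of a countable, locally finite graph are countable** (they are indexed by
darts). [folklore] -/
theorem countable_usedFaces [Countable V] : Countable emb.usedFaces := by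
  have : Countable G.Dart := Function.Injective.countable (f := SimpleGraph.Dart.toProd)
    fun d d' h => SimpleGraph.Dart.ext _ _ h
  have hc : (emb.usedFaces).Countable := by
    have : emb.usedFaces ⊆ Set.range emb.leftFace ∪ Set.range emb.rightFace := by
      rintro f ⟨d, h | h⟩
      · exact Or.inl ⟨d, h⟩
      · exact Or.inr ⟨d, h⟩
    exact ((Set.countable_range _).union (Set.countable_range _)).mono this
  exact hc.to_subtype

/-! ### Tracks -/

section Tracks

/-- The side map of the restriction: forget that the face is used. [folklore] -/
def usedSideMap (emb : RhombicEmbedding G F) : V × emb.usedFaces → V × F := fun p => (p.1, (p.2 : F))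

/-- `usedSideMap` is injective. [folklore] -/
theorem usedSideMap_injective : Function.Injective (usedSideMap emb) := by
  rintro ⟨v, f⟩ ⟨v', f'⟩ h
  simp only [usedSideMap, Prod.mk.injEq] at h
  exact Prod.ext h.1 (Subtype.ext h.2)

variable [DecidableEq V] [DecidableEq F]

/-- Sides of the restriction, forgotten, are the sides. [folklore] -/
theorem dartSides_restrictFaces (d : G.Dart) :
    emb.dartSides d = (emb.restrictFaces.dartSides d).image (usedSideMap emb) := by
  simp [RhombicEmbedding.dartSides, Finset.image_insert, usedSideMap,
    RhombicEmbedding.restrictFaces]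

/-- Opposite sides of the restriction, forgotten, are the opposite sides. [folklore] -/
theorem dartOppositeSide_restrictFaces (d : G.Dart) (p : V × emb.usedFaces) :
    usedSideMap emb (emb.restrictFaces.dartOppositeSide d p) =
      emb.dartOppositeSide d (usedSideMap emb p) := by
  have key : ∀ (v : V) (f : emb.usedFaces), p = (v, f) ↔ usedSideMap emb p = (v, (f : F)) :=
    fun v f => ⟨fun h => by subst h; rfl, fun h => usedSideMap_injective h⟩
  have k1 : p = (d.fst, emb.restrictFaces.leftFace d) ↔ usedSideMap emb p = (d.fst, emb.leftFace d) :=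
    key _ _
  have k2 : p = (d.snd, emb.restrictFaces.rightFace d) ↔
      usedSideMap emb p = (d.snd, emb.rightFace d) := key _ _
  have k3 : p = (d.snd, emb.restrictFaces.leftFace d) ↔ usedSideMap emb p = (d.snd, emb.leftFace d) :=
    key _ _
  have k4 : p = (d.fst, emb.restrictFaces.rightFace d) ↔
      usedSideMap emb p = (d.fst, emb.rightFace d) := key _ _
  unfold RhombicEmbedding.dartOppositeSide
  by_cases h1 : p = (d.fst, emb.restrictFaces.leftFace d)
  · rw [if_pos h1, if_pos (k1.1 h1)]; rfl
  rw [if_neg h1, if_neg (mt k1.2 h1)]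
  by_cases h2 : p = (d.snd, emb.restrictFaces.rightFace d)
  · rw [if_pos h2, if_pos (k2.1 h2)]; rfl
  rw [if_neg h2, if_neg (mt k2.2 h2)]
  by_cases h3 : p = (d.snd, emb.restrictFaces.leftFace d)
  · rw [if_pos h3, if_pos (k3.1 h3)]; rfl
  rw [if_neg h3, if_neg (mt k3.2 h3)]
  by_cases h4 : p = (d.fst, emb.restrictFaces.rightFace d)
  · rw [if_pos h4, if_pos (k4.1 h4)]; rfl
  rw [if_neg h4, if_neg (mt k4.2 h4)]

/-- **The restriction is side-compatible with the embedding** (identity on edges, forgetting the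
used-ness of faces on sides). [folklore] -/
theorem isSideCompatible_restrictFaces :
    IsSideCompatible emb.restrictFaces emb (Equiv.refl _) (usedSideMap emb) where
  injective := usedSideMap_injective
  sides_eq e := dartSides_restrictFaces (refDart e)
  oppositeSide_eq e p _ := dartOppositeSide_restrictFaces (refDart e) p

/-- SGP(I) for the restriction, from SGP(I). [cite: GrimmettManolescu2014Isoradial, §4.2 (SGP(I))] -/
theorem _root_.Literature.Probability.LatticeModels.RhombicEmbedding.SquareGridPropertyGM.restrictFaces
    {I : ℕ} (h : emb.SquareGridPropertyGM I) : emb.restrictFaces.SquareGridPropertyGM I :=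
  isSideCompatible_restrictFaces.squareGridPropertyGM_symm h

/-- SGP(I), from SGP(I) for the restriction. [cite: GrimmettManolescu2014Isoradial, §4.2 (SGP(I))] -/
theorem squareGridPropertyGM_of_restrictFaces {I : ℕ}
    (h : emb.restrictFaces.SquareGridPropertyGM I) : emb.SquareGridPropertyGM I := by
  simpa using isSideCompatible_restrictFaces.squareGridPropertyGM h

/-- The printed square-grid property for the restriction, from the property.
[cite: GrimmettManolescu2014Isoradial, §4.2 (SGP(I))] -/
theorem _root_.Literature.Probability.LatticeModels.RhombicEmbedding.HasSquareGridPropertyGM.restrictFaces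
    (h : emb.HasSquareGridPropertyGM) : emb.restrictFaces.HasSquareGridPropertyGM :=
  isSideCompatible_restrictFaces.hasSquareGridPropertyGM_symm h

end Tracks

end Literature.Probability.Percolation

end
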